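import Summits.CriticalPhenomena.PercolationContinuityZ3.Theorems.PercNearOneGluingNoHeavyLowerTailPcovJ1World
import Summits.CriticalPhenomena.PercolationContinuityZ3.Theorems.PercNearOneGluingNoHeavyLowerTailMixMetaA2
import HarnessLib

/-!
# KN Question 8 at `|A| = 3`: THEOREM (T3) — positive association "in the frame" — by the two-source induction

Support file (`--supports stmt-CriticalPhenomena-4575`, closed crux; independent mathematics on Kozma–Nitzan's Question 8 at
`|A| = 3`), prover `prim-hp-7` (gen 39).  No named facts, no sorries; standard axioms.
Memo `prim-ineq-gen-7/FINDING-TSTAR-g12.md` §1 (THEOREM (T3) = "PAC in the frame", the mass piece of PS5-int; proof = van den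
Berg–Häggström–Kahn's Thm 1.1 induction with two sources; "LEAN ROUTE: `CovTau.metaA2_abstract` with (f₁,f₂,f₃,f₄) = (e, pv, pm, a)").

Owner `x`, plain observer `o`, pocket observer `v` (pairwise distinct).  For vertex sets `X, Y′` the TWO-PARAMETER FAMILY of the memo,
  `Φ(X, Y′):  e(X) · pv(Y′) ≤ a(X ∩ Y′) · pm(X ∪ Y′)`,
  `e(N)  = μ(o ∈ C_v, v ↮ {x} ∪ N, x ↮ N)`            (`PcovJ1.eT`),
  `pv(N) = μ(v ∈ C_x, x ↮ N, o ↮ {x, v} ∪ N)`          (`PcovJ1.pvT`),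
  `pm(M) = μ(x ↮ {o, v} ∪ M, o ↮ {v} ∪ M, v ↮ M)`      (`PcovJ1.pmT`; = `{x, o, v pairwise separated} ∩ {x, o, v ↮ M}`),
  `a(K)  = μ(o ∈ C_x, x ↮ K)`                          (`CovTau.Eav w U ∅ o x K`),
in the finite-sum world framework of `CovTau` (world `U : Finset V`; in a world the events also ask `x ∈ U` resp. `o ∈ U`).
* `PcovJ1.threeAvoid_step` — BHK's identity (6) for a product of THREE avoidance indicators (three clusters avoiding sets containing `Z`).
* `PcovJ1.eT_step`, `PcovJ1.pvT_step`, `PcovJ1.pmT_step` — the star decompositions; `PcovJ1.t3_base` — `e(N)·pv(N′) ≤ pm(N ∪ N′)·a(∅)`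
  for ALL `N, N′` by Ahlswede–Daykin on the configuration lattice (`ω ∨ ω′` contains the path `x – v – o`; `ω ∧ ω′` is pairwise
  separated and avoids `N ∪ N′`).
* `PcovJ1.t3_twoSource` — `Φ(N, N′)` for all `N, N′ ⊆ U` (`CovTau.metaA2_abstract`); `PcovJ1.t3_frame` — the diagonal `N = N′ = Y`:
  **(T3)**  `μ(o~v, v≁x, {x,o}↮Y) · μ(v~x, o≁x, o≁v, {x,o}↮Y) ≤ μ(x,o,v pairwise separated, {x,o,v}↮Y) · μ(o ∈ C_x, {x,o}↮Y)`,
  i.e. `ν′(E)·ν′(PV) ≤ ν′(PM ∩ {v↮Y})·ν′(O)` in the frame `ν′ = μ(· | {x,o} ↮ Y)` (the `prodBernoulli` form is in the companion file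
  `…KnQuestion8FramePACMeasure.lean`).
[cite: VandenbergHaggstromKahn2005, Thm. 1.1 (pp. 3–5), §1 identity (6) (p. 4)] [cite: AhlswedeDaykin1978, Thm. 1]
[cite: KozmaNitzan2024, Question 8 (§5.5 p. 36)]
-/

noncomputable section

namespace Summit.CriticalPhenomena.PercolationContinuityZ3.Theorems

namespace PcovJ1

open Literature.Probability.Percolation
open Literature.Probability.Percolation.BHK2006
open Literature.Probability.Percolation.DecisionTree (ind ind_of_mem ind_of_not_mem ind_nonneg)
open CovTau
open scoped Classical

variable {V : Type*}

/-! ### BHK's identity (6) for three avoidance indicators -/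

/-- One avoidance indicator read in `G[U ∖ Z]` after deleting the pairs meeting `Z` (`BHK2006.mem_rD_iff_restrict`). [folklore] -/
theorem ind_rD_restrict {U Z : Finset V} (hZU : Z ⊆ U) {s : V} (hs : s ∉ Z) {W : Set V} (hZW : (↑Z : Set V) ⊆ W)
    (ω : Set (Sym2 V)) :
    ind (rD U s W) ω = ind (rD (U \ Z) s ((W \ ↑Z) ∪ rS U Z ω)) (ω \ meeting Z) := by
  refine BystanderBHK.ind_congr ?_
  rw [mem_rD_iff_restrict hZU hs hZW ω, mem_rD_diff_meeting]

/-- Avoidance events of `G[U ∖ Z]` ignore the pairs meeting `Z`. [folklore] -/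
theorem ind_rD_diff_meeting (U Z : Finset V) (s : V) (T : Set V) (ω : Set (Sym2 V)) :
    ind (rD (U \ Z) s T) (ω \ meeting Z) = ind (rD (U \ Z) s T) ω :=
  BystanderBHK.ind_congr (mem_rD_diff_meeting U Z s T ω)

variable [Fintype V]

/-- **Three-cluster star decomposition (BHK's identity (6))**: for `Z ⊆ U`, `s₁, s₂, s₃ ∉ Z` and `Z ⊆ W₁, W₂, W₃`,
`E_U[Π_i 1{s_i ↮ W_i}] = Σ_ω weight(ω)·E_{U∖Z}[Π_i 1{s_i ↮ (W_i ∖ Z) ∪ S(ω)}]`, conditioning on the set `S(ω)` of vertices joined to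
`Z` by an open edge. [cite: VandenbergHaggstromKahn2005, §1 p. 4, identity (6)] -/
theorem threeAvoid_step {U Z : Finset V} (hZU : Z ⊆ U) {s₁ s₂ s₃ : V} (h₁ : s₁ ∉ Z) (h₂ : s₂ ∉ Z) (h₃ : s₃ ∉ Z)
    {W₁ W₂ W₃ : Set V} (hW₁ : (↑Z : Set V) ⊆ W₁) (hW₂ : (↑Z : Set V) ⊆ W₂) (hW₃ : (↑Z : Set V) ⊆ W₃)
    (w : Sym2 V → ℝ) (hm : ∑ ω, weight w ω = 1) :
    ∑ ω, weight w ω * (ind (rD U s₁ W₁) ω * ind (rD U s₂ W₂) ω * ind (rD U s₃ W₃) ω) =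
      ∑ ω, weight w ω * ∑ ω', weight w ω' *
        (ind (rD (U \ Z) s₁ ((W₁ \ ↑Z) ∪ rS U Z ω)) ω' * ind (rD (U \ Z) s₂ ((W₂ \ ↑Z) ∪ rS U Z ω)) ω' *
          ind (rD (U \ Z) s₃ ((W₃ \ ↑Z) ∪ rS U Z ω)) ω') := by
  set A := meeting Z with hA
  set Φ : Set (Sym2 V) → Set (Sym2 V) → ℝ := fun ζ η =>
    ind (rD (U \ Z) s₁ ((W₁ \ ↑Z) ∪ rS U Z ζ)) η * ind (rD (U \ Z) s₂ ((W₂ \ ↑Z) ∪ rS U Z ζ)) η *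
      ind (rD (U \ Z) s₃ ((W₃ \ ↑Z) ∪ rS U Z ζ)) η with hΦ
  have h1 : ∀ ω, ind (rD U s₁ W₁) ω * ind (rD U s₂ W₂) ω * ind (rD U s₃ W₃) ω = Φ (ω ∩ A) (ω \ A) := by
    intro ω
    simp only [hΦ, hA, rS_inter_meeting]
    rw [ind_rD_restrict hZU h₁ hW₁ ω, ind_rD_restrict hZU h₂ hW₂ ω, ind_rD_restrict hZU h₃ hW₃ ω]
  have h2 : ∀ ω ω', Φ (ω ∩ A) (ω' \ A) =
      ind (rD (U \ Z) s₁ ((W₁ \ ↑Z) ∪ rS U Z ω)) ω' * ind (rD (U \ Z) s₂ ((W₂ \ ↑Z) ∪ rS U Z ω)) ω' *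
        ind (rD (U \ Z) s₃ ((W₃ \ ↑Z) ∪ rS U Z ω)) ω' := by
    intro ω ω'
    simp only [hΦ, hA, rS_inter_meeting, ind_rD_diff_meeting]
  calc ∑ ω, weight w ω * (ind (rD U s₁ W₁) ω * ind (rD U s₂ W₂) ω * ind (rD U s₃ W₃) ω)
      = (∑ ω, weight w ω) * ∑ ω, weight w ω * Φ (ω ∩ A) (ω \ A) := by
        rw [hm, one_mul]; simp_rw [h1]
    _ = ∑ ω, weight w ω * ∑ ω', weight w ω' * Φ (ω ∩ A) (ω' \ A) := blockFubini w A Φ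
    _ = _ := by simp_rw [h2]

/-! ### The functionals `e`, `pv`, `pm` of the two-parameter family -/

/-- `e(N) = μ_{G[U]}(o ∈ C_v, v ↮ {x} ∪ N, x ∈ U, x ↮ N)` (memo: `e(X)`, the event `E = {o~v, v≁x}` with both sources avoiding `X`).
[cite: KozmaNitzan2024, Question 8 (§5.5 p. 36)] -/
def eT (w : Sym2 V → ℝ) (U : Finset V) (x o v : V) (N : Set V) : ℝ :=
  ∑ ω, weight w ω * (oInd o v (rC U v ω) * ind (rD U v (insert x N)) ω * ind (avoidAll U {x} N) ω)

/-- `pv(N) = μ_{G[U]}(v ∈ C_x, x ↮ N, o ∈ U, o ↮ {x, v} ∪ N)` (memo: `pv(Y′)`, the atom `PV` with the sources avoiding `Y′`).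
[cite: KozmaNitzan2024, Question 8 (§5.5 p. 36)] -/
def pvT (w : Sym2 V → ℝ) (U : Finset V) (x o v : V) (N : Set V) : ℝ :=
  ∑ ω, weight w ω * (oInd v x (rC U x ω) * ind (rD U x N) ω * ind (avoidAll U {o} (insert x (insert v N))) ω)

/-- `pm(M) = μ_{G[U]}(x ↮ {o, v} ∪ M, o ↮ {v} ∪ M, v ↮ M)` (memo: `pm(X ∪ Y′)` = pairwise separation of `x, o, v` and avoidance of `M`).
[cite: KozmaNitzan2024, Question 8 (§5.5 p. 36)] -/
def pmT (w : Sym2 V → ℝ) (U : Finset V) (x o v : V) (M : Set V) : ℝ :=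
  ∑ ω, weight w ω * (ind (rD U x (insert o (insert v M))) ω * ind (rD U o (insert v M)) ω * ind (rD U v M) ω)

section Props

variable {w : Sym2 V → ℝ} (hw0 : ∀ e, 0 ≤ w e) (hw1 : ∀ e, w e ≤ 1)
include hw0 hw1

/-- `e ≥ 0`. [folklore] -/
theorem eT_nonneg (U : Finset V) (x o v : V) (N : Set V) : 0 ≤ eT w U x o v N :=
  Finset.sum_nonneg fun ω _ => mul_nonneg (weight_nonneg hw0 hw1 ω)
    (mul_nonneg (mul_nonneg (oInd_nonneg _ _ _) (ind_nonneg _ _)) (ind_nonneg _ _))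

/-- `pv ≥ 0`. [folklore] -/
theorem pvT_nonneg (U : Finset V) (x o v : V) (N : Set V) : 0 ≤ pvT w U x o v N :=
  Finset.sum_nonneg fun ω _ => mul_nonneg (weight_nonneg hw0 hw1 ω)
    (mul_nonneg (mul_nonneg (oInd_nonneg _ _ _) (ind_nonneg _ _)) (ind_nonneg _ _))

/-- `pm ≥ 0`. [folklore] -/
theorem pmT_nonneg (U : Finset V) (x o v : V) (M : Set V) : 0 ≤ pmT w U x o v M :=
  Finset.sum_nonneg fun ω _ => mul_nonneg (weight_nonneg hw0 hw1 ω)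
    (mul_nonneg (mul_nonneg (ind_nonneg _ _) (ind_nonneg _ _)) (ind_nonneg _ _))

/-- `e` is antitone in the source set. [cite: VandenbergHaggstromKahn2005, §1 p. 3] -/
theorem eT_antitone (U : Finset V) (x o v : V) {N N' : Set V} (h : N ⊆ N') : eT w U x o v N' ≤ eT w U x o v N := by
  unfold eT
  refine Finset.sum_le_sum fun ω _ => mul_le_mul_of_nonneg_left ?_ (weight_nonneg hw0 hw1 ω)
  exact mul_le_mul (mul_le_mul_of_nonneg_left (ind_mono (rD_antitone (Set.insert_subset_insert h)) ω) (oInd_nonneg _ _ _))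
    (ind_mono (avoidAll_antitone U {x} h) ω) (ind_nonneg _ _) (mul_nonneg (oInd_nonneg _ _ _) (ind_nonneg _ _))

/-- `pv` is antitone in the source set. [cite: VandenbergHaggstromKahn2005, §1 p. 3] -/
theorem pvT_antitone (U : Finset V) (x o v : V) {N N' : Set V} (h : N ⊆ N') : pvT w U x o v N' ≤ pvT w U x o v N := by
  unfold pvT
  refine Finset.sum_le_sum fun ω _ => mul_le_mul_of_nonneg_left ?_ (weight_nonneg hw0 hw1 ω)
  exact mul_le_mul (mul_le_mul_of_nonneg_left (ind_mono (rD_antitone h) ω) (oInd_nonneg _ _ _))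
    (ind_mono (avoidAll_antitone U {o} (Set.insert_subset_insert (Set.insert_subset_insert h))) ω) (ind_nonneg _ _)
    (mul_nonneg (oInd_nonneg _ _ _) (ind_nonneg _ _))

end Props

/-! ### Vanishing cases (admissibility) -/

/-- `e(N) ≠ 0 ⟹ x ∈ U, v ∈ U and x, o, v ∉ N` (for `o ≠ v`). [folklore] -/
theorem eT_ne_zero (w : Sym2 V → ℝ) {U : Finset V} {x o v : V} (hov : o ≠ v) {N : Set V} (h : eT w U x o v N ≠ 0) :
    x ∈ U ∧ v ∈ U ∧ x ∉ N ∧ o ∉ N ∧ v ∉ N := by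
  by_contra hc
  apply h
  refine Finset.sum_eq_zero fun ω _ => ?_
  by_cases hA : ω ∈ avoidAll U {x} N
  · have hxU : x ∈ U := (mem_avoidAll_singleton.1 hA).1
    have hxN : x ∉ N := fun hxN => (mem_avoidAll_singleton.1 hA).2 x hxN (SimpleGraph.Reachable.refl x)
    by_cases hD : ω ∈ rD U v (insert x N)
    · have hvN : v ∉ N := fun hvN => hD v (Set.mem_insert_of_mem x hvN) (SimpleGraph.Reachable.refl v)
      by_cases hO : (openGraph (ω ∩ edgesIn U)).Reachable v o
      · have hvU : v ∈ U := SandwichBHK.mem_of_reachable hO.symm hov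
        have hoN : o ∉ N := fun hoN => hD o (Set.mem_insert_of_mem x hoN) hO
        exact absurd ⟨hxU, hvU, hxN, hoN, hvN⟩ hc
      · rw [oInd_rC, ind_of_not_mem (show ω ∉ {ω : Set (Sym2 V) | (openGraph (ω ∩ edgesIn U)).Reachable v o} from hO)]
        ring
    · rw [ind_of_not_mem hD]; ring
  · rw [ind_of_not_mem hA]; ring

/-- `pv(N) ≠ 0 ⟹ o ∈ U and o ∉ N`. [folklore] -/
theorem pvT_ne_zero (w : Sym2 V → ℝ) {U : Finset V} {x o v : V} {N : Set V} (h : pvT w U x o v N ≠ 0) :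
    o ∈ U ∧ o ∉ N := by
  by_contra hc
  apply h
  refine Finset.sum_eq_zero fun ω _ => ?_
  by_cases hA : ω ∈ avoidAll U {o} (insert x (insert v N))
  · have hoU : o ∈ U := (mem_avoidAll_singleton.1 hA).1
    have hoN : o ∉ N := fun hoN =>
      (mem_avoidAll_singleton.1 hA).2 o (Set.mem_insert_of_mem x (Set.mem_insert_of_mem v hoN)) (SimpleGraph.Reachable.refl o)
    exact absurd ⟨hoU, hoN⟩ hc
  · rw [ind_of_not_mem hA]; ring

/-! ### Star decompositions -/

/-- Star decomposition of `e` (`CovTau.multiStep_sum`). [cite: VandenbergHaggstromKahn2005, §1 p. 4, identity (6)] -/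
theorem eT_step {U Z : Finset V} (hZU : Z ⊆ U) {x o v : V} (hx : x ∉ Z) (hv : v ∉ Z) {N : Set V}
    (hZN : (↑Z : Set V) ⊆ N) (w : Sym2 V → ℝ) (hm : ∑ ω, weight w ω = 1) :
    eT w U x o v N = ∑ ω, weight w ω * eT w (U \ Z) x o v ((N \ ↑Z) ∪ rS U Z ω) := by
  have hZW : (↑Z : Set V) ⊆ insert x N := hZN.trans (Set.subset_insert x N)
  unfold eT
  rw [multiStep_sum hZU hv hZW {x} hZN w hm (oInd o v)]
  refine Finset.sum_congr rfl fun ω _ => ?_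
  simp only [insert_diff_union hx]

/-- Star decomposition of `pv` (`CovTau.multiStep_sum`). [cite: VandenbergHaggstromKahn2005, §1 p. 4, identity (6)] -/
theorem pvT_step {U Z : Finset V} (hZU : Z ⊆ U) {x o v : V} (hx : x ∉ Z) (hv : v ∉ Z) {N : Set V}
    (hZN : (↑Z : Set V) ⊆ N) (w : Sym2 V → ℝ) (hm : ∑ ω, weight w ω = 1) :
    pvT w U x o v N = ∑ ω, weight w ω * pvT w (U \ Z) x o v ((N \ ↑Z) ∪ rS U Z ω) := by
  have hZW' : (↑Z : Set V) ⊆ insert x (insert v N) := hZN.trans ((Set.subset_insert v N).trans (Set.subset_insert x _))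
  unfold pvT
  rw [multiStep_sum hZU hx hZN {o} hZW' w hm (oInd v x)]
  refine Finset.sum_congr rfl fun ω _ => ?_
  simp only [insert_diff_union hx, insert_diff_union hv]

/-- Star decomposition of `pm` (`PcovJ1.threeAvoid_step`). [cite: VandenbergHaggstromKahn2005, §1 p. 4, identity (6)] -/
theorem pmT_step {U Z : Finset V} (hZU : Z ⊆ U) {x o v : V} (hx : x ∉ Z) (ho : o ∉ Z) (hv : v ∉ Z) {M : Set V}
    (hZM : (↑Z : Set V) ⊆ M) (w : Sym2 V → ℝ) (hm : ∑ ω, weight w ω = 1) :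
    pmT w U x o v M = ∑ ω, weight w ω * pmT w (U \ Z) x o v ((M \ ↑Z) ∪ rS U Z ω) := by
  have hW₂ : (↑Z : Set V) ⊆ insert v M := hZM.trans (Set.subset_insert v M)
  have hW₁ : (↑Z : Set V) ⊆ insert o (insert v M) := hW₂.trans (Set.subset_insert o _)
  unfold pmT
  rw [threeAvoid_step hZU hx ho hv hW₁ hW₂ hZM w hm]
  refine Finset.sum_congr rfl fun ω _ => ?_
  simp only [insert_diff_union ho, insert_diff_union hv]

/-! ### The disjoint-sources base by Ahlswede–Daykin -/

omit [Fintype V] in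
/-- Reachability inside `G[U]` is monotone in the configuration. [folklore] -/
theorem reach_mono {U : Finset V} {a b : Set (Sym2 V)} (h : a ⊆ b) {s t : V}
    (hr : (openGraph (a ∩ edgesIn U)).Reachable s t) : (openGraph (b ∩ edgesIn U)).Reachable s t :=
  hr.mono (openGraph_le (Set.inter_subset_inter_left _ h))

/-- **The base `e(N)·pv(N′) ≤ pm(N ∪ N′)·a(∅)` for ALL `N, N′`** (memo §1, "Base"): Ahlswede–Daykin on the configuration lattice — for
`ω` in the `e(N)`-event and `ω′` in the `pv(N′)`-event, `ω ∪ ω′` contains the path `x – v – o`, and `ω ∩ ω′` separates `x, o, v`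
pairwise and from `N ∪ N′`. [cite: AhlswedeDaykin1978, Thm. 1] [cite: VandenbergHaggstromKahn2005, Thm. 1.1 (pp. 3–5)] -/
theorem t3_base (w : Sym2 V → ℝ) (hw0 : ∀ e, 0 ≤ w e) (hw1 : ∀ e, w e ≤ 1) (U : Finset V) (x o v : V)
    (N N' : Set V) : eT w U x o v N * pvT w U x o v N' ≤ pmT w U x o v (N ∪ N') * Eav w U ∅ o x ∅ := by
  -- the four {0,1}-integrands
  set ι₁ : Set (Sym2 V) → ℝ := fun ω =>
    oInd o v (rC U v ω) * ind (rD U v (insert x N)) ω * ind (avoidAll U {x} N) ω with hι₁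
  set ι₂ : Set (Sym2 V) → ℝ := fun ω =>
    oInd v x (rC U x ω) * ind (rD U x N') ω * ind (avoidAll U {o} (insert x (insert v N'))) ω with hι₂
  set ι₃ : Set (Sym2 V) → ℝ := fun ω =>
    ind (rD U x (insert o (insert v (N ∪ N')))) ω * ind (rD U o (insert v (N ∪ N'))) ω * ind (rD U v (N ∪ N')) ω with hι₃
  set ι₄ : Set (Sym2 V) → ℝ := fun ω => oInd o x (rC U x ω) * ind (rD U x (∅ ∪ ∅)) ω with hι₄
  have h1n : ∀ ω, 0 ≤ ι₁ ω := fun ω => mul_nonneg (mul_nonneg (oInd_nonneg _ _ _) (ind_nonneg _ _)) (ind_nonneg _ _)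
  have h2n : ∀ ω, 0 ≤ ι₂ ω := fun ω => mul_nonneg (mul_nonneg (oInd_nonneg _ _ _) (ind_nonneg _ _)) (ind_nonneg _ _)
  have h3n : ∀ ω, 0 ≤ ι₃ ω := fun ω => mul_nonneg (mul_nonneg (ind_nonneg _ _) (ind_nonneg _ _)) (ind_nonneg _ _)
  have h4n : ∀ ω, 0 ≤ ι₄ ω := fun ω => mul_nonneg (oInd_nonneg _ _ _) (ind_nonneg _ _)
  have h1le : ∀ ω, ι₁ ω ≤ 1 := fun ω => by
    have := mul_le_one₀ (mul_le_one₀ (oInd_le_one o v (rC U v ω)) (ind_nonneg _ _) (ind_le_one (rD U v (insert x N)) ω))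
      (ind_nonneg _ _) (ind_le_one (avoidAll U {x} N) ω)
    exact this
  have h2le : ∀ ω, ι₂ ω ≤ 1 := fun ω => by
    have := mul_le_one₀ (mul_le_one₀ (oInd_le_one v x (rC U x ω)) (ind_nonneg _ _) (ind_le_one (rD U x N') ω))
      (ind_nonneg _ _) (ind_le_one (avoidAll U {o} (insert x (insert v N'))) ω)
    exact this
  -- the pointwise Ahlswede–Daykin hypothesis
  have key : ∀ a b : Set (Sym2 V), ι₁ a * ι₂ b ≤ ι₃ (a ∩ b) * ι₄ (a ∪ b) := by
    intro a b
    by_cases hfull : (openGraph (a ∩ edgesIn U)).Reachable v o ∧ a ∈ rD U v (insert x N) ∧ a ∈ avoidAll U {x} N ∧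
        (openGraph (b ∩ edgesIn U)).Reachable x v ∧ b ∈ rD U x N' ∧ b ∈ avoidAll U {o} (insert x (insert v N'))
    · obtain ⟨hvo, haD, haA, hxv, hbD, hbA⟩ := hfull
      have haX : ∀ t ∈ N, ¬ (openGraph (a ∩ edgesIn U)).Reachable x t := fun t ht => (mem_avoidAll_singleton.1 haA).2 t ht
      have hbO : ∀ t ∈ insert x (insert v N'), ¬ (openGraph (b ∩ edgesIn U)).Reachable o t :=
        fun t ht => (mem_avoidAll_singleton.1 hbA).2 t ht
      -- `a ∩ b` is in the `pm(N ∪ N')`-event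
      have h3 : ι₃ (a ∩ b) = 1 := by
        have i1 : a ∩ b ∈ rD U x (insert o (insert v (N ∪ N'))) := by
          intro t ht hr
          rcases ht with rfl | rfl | ht
          · exact hbO x (Set.mem_insert x _) (reach_mono Set.inter_subset_right hr).symm
          · exact haD x (Set.mem_insert x N) (reach_mono Set.inter_subset_left hr).symm
          · rcases ht with ht | ht
            · exact haX t ht (reach_mono Set.inter_subset_left hr)
            · exact hbD t ht (reach_mono Set.inter_subset_right hr)
        have i2 : a ∩ b ∈ rD U o (insert v (N ∪ N')) := by
          intro t ht hr
          rcases ht with rfl | ht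
          · exact hbO t (Set.mem_insert_of_mem x (Set.mem_insert t N')) (reach_mono Set.inter_subset_right hr)
          · rcases ht with ht | ht
            · exact haD t (Set.mem_insert_of_mem x ht) (hvo.trans (reach_mono Set.inter_subset_left hr))
            · exact hbO t (Set.mem_insert_of_mem x (Set.mem_insert_of_mem v ht)) (reach_mono Set.inter_subset_right hr)
        have i3 : a ∩ b ∈ rD U v (N ∪ N') := by
          intro t ht hr
          rcases ht with ht | ht
          · exact haD t (Set.mem_insert_of_mem x ht) (reach_mono Set.inter_subset_left hr)
          · exact hbD t ht (hxv.trans (reach_mono Set.inter_subset_right hr))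
        simp only [hι₃, ind_of_mem i1, ind_of_mem i2, ind_of_mem i3, mul_one]
      -- `a ∪ b` is in the `a(∅)`-event: the path `x – v – o`
      have h4 : ι₄ (a ∪ b) = 1 := by
        have hxo : (openGraph ((a ∪ b) ∩ edgesIn U)).Reachable x o :=
          (reach_mono Set.subset_union_right hxv).trans (reach_mono Set.subset_union_left hvo)
        have i4 : a ∪ b ∈ rD U x (∅ ∪ ∅ : Set V) := fun t ht => by simp at ht
        simp only [hι₄, oInd_rC, ind_of_mem (show a ∪ b ∈ {ω : Set (Sym2 V) | (openGraph (ω ∩ edgesIn U)).Reachable x o}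
          from hxo), ind_of_mem i4, mul_one]
      rw [h3, h4, mul_one]
      exact mul_le_one₀ (h1le a) (h2n b) (h2le b)
    · -- otherwise the left-hand side vanishes
      have hzero : ι₁ a * ι₂ b = 0 := by
        simp only [hι₁, hι₂, oInd_rC]
        by_cases q1 : (openGraph (a ∩ edgesIn U)).Reachable v o
        · by_cases q2 : a ∈ rD U v (insert x N)
          · by_cases q3 : a ∈ avoidAll U {x} N
            · by_cases q4 : (openGraph (b ∩ edgesIn U)).Reachable x v
              · by_cases q5 : b ∈ rD U x N'
                · have q6 : b ∉ avoidAll U {o} (insert x (insert v N')) := fun q6 => hfull ⟨q1, q2, q3, q4, q5, q6⟩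
                  rw [ind_of_not_mem q6]; ring
                · rw [ind_of_not_mem q5]; ring
              · rw [ind_of_not_mem (show b ∉ {ω : Set (Sym2 V) | (openGraph (ω ∩ edgesIn U)).Reachable x v} from q4)]; ring
            · rw [ind_of_not_mem q3]; ring
          · rw [ind_of_not_mem q2]; ring
        · rw [ind_of_not_mem (show a ∉ {ω : Set (Sym2 V) | (openGraph (ω ∩ edgesIn U)).Reachable v o} from q1)]; ring
      rw [hzero]
      exact mul_nonneg (h3n _) (h4n _)
  -- Ahlswede–Daykin for the log-modular product weight
  have hw := fun ω => weight_nonneg hw0 hw1 ω (w := w)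
  have AD := four_functions_theorem_univ (fun ω => weight w ω * ι₁ ω) (fun ω => weight w ω * ι₂ ω)
    (fun ω => weight w ω * ι₃ ω) (fun ω => weight w ω * ι₄ ω)
    (fun ω => mul_nonneg (hw ω) (h1n ω)) (fun ω => mul_nonneg (hw ω) (h2n ω))
    (fun ω => mul_nonneg (hw ω) (h3n ω)) (fun ω => mul_nonneg (hw ω) (h4n ω)) (fun a b => by
      show weight w a * ι₁ a * (weight w b * ι₂ b) ≤ weight w (a ∩ b) * ι₃ (a ∩ b) * (weight w (a ∪ b) * ι₄ (a ∪ b))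
      calc weight w a * ι₁ a * (weight w b * ι₂ b) = (weight w a * weight w b) * (ι₁ a * ι₂ b) := by ring
        _ ≤ (weight w (a ∩ b) * weight w (a ∪ b)) * (ι₃ (a ∩ b) * ι₄ (a ∪ b)) := by
            rw [weight_inter_mul_union w a b]
            exact mul_le_mul_of_nonneg_left (key a b) (mul_nonneg (hw _) (hw _))
        _ = _ := by ring)
  unfold eT pvT pmT Eav
  exact AD

/-! ### (T3) by the two-source induction -/

/-- **The two-parameter family `Φ(N, N′)`** (memo §1): for `o ≠ v` and all `N, N′ ⊆ U`,
`e(N) · pv(N′) ≤ pm(N ∪ N′) · a(N ∩ N′)` in `G[U]`. [cite: VandenbergHaggstromKahn2005, Thm. 1.1 (pp. 3–5)]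
[cite: KozmaNitzan2024, Question 8 (§5.5 p. 36)] -/
theorem t3_twoSource (w : Sym2 V → ℝ) (hw0 : ∀ e, 0 ≤ w e) (hw1 : ∀ e, w e ≤ 1) (hm : ∑ ω, weight w ω = 1)
    {x o v : V} (hov : o ≠ v) (U : Finset V) :
    ∀ N N' : Set V, N ⊆ ↑U → N' ⊆ ↑U →
      eT w U x o v N * pvT w U x o v N' ≤ pmT w U x o v (N ∪ N') * Eav w U ∅ o x (N ∩ N') := by
  refine metaA2_abstract w hw0 hw1 hm (fun U' Z' => x ∈ U' ∧ x ∉ Z' ∧ o ∉ Z' ∧ v ∉ Z')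
    (fun U' N => eT w U' x o v N) (fun U' N => pvT w U' x o v N) (fun U' M => pmT w U' x o v M)
    (fun U' K => Eav w U' ∅ o x K)
    (fun U' N => eT_nonneg hw0 hw1 U' x o v N) (fun U' N => pvT_nonneg hw0 hw1 U' x o v N)
    (fun U' M => pmT_nonneg hw0 hw1 U' x o v M) (fun U' K => Eav_nonneg hw0 hw1 U' ∅ o x K) U
    ?_ ?_ ?_ ?_ ?_ ?_ ?_ ?_
  · -- admissibility from non-vanishing
    intro U' _ N N' _ _ hne Z' _ hZ'
    have h1 : eT w U' x o v N ≠ 0 := fun h => hne (by rw [h, zero_mul])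
    have h2 : pvT w U' x o v N' ≠ 0 := fun h => hne (by rw [h, mul_zero])
    obtain ⟨hxU', -, hxN, hoN, hvN⟩ := eT_ne_zero w hov h1
    exact ⟨hxU', fun hz => hxN (hZ' (Finset.mem_coe.2 hz)).1, fun hz => hoN (hZ' (Finset.mem_coe.2 hz)).1,
      fun hz => hvN (hZ' (Finset.mem_coe.2 hz)).1⟩
  · intro U' _ Z' hZU' hAdm _ N hZN _
    exact eT_step hZU' hAdm.2.1 hAdm.2.2.2 hZN w hm
  · intro U' _ Z' hZU' hAdm _ N hZN _
    exact pvT_step hZU' hAdm.2.1 hAdm.2.2.2 hZN w hm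
  · intro U' _ Z' hZU' hAdm _ N hZN _
    exact pmT_step hZU' hAdm.2.1 hAdm.2.2.1 hAdm.2.2.2 hZN w hm
  · intro U' _ Z' hZU' hAdm _ N hZN _
    have h := Eav_step hZU' hAdm.1 hAdm.2.1 (A := (∅ : Set V)) hZN w hm o
    exact h
  · intro U' _ N N' hNN' _
    exact eT_antitone hw0 hw1 U' x o v hNN'
  · intro U' _ N N' hNN' _
    exact pvT_antitone hw0 hw1 U' x o v hNN'
  · intro U' _ N N' _ _ _
    exact t3_base w hw0 hw1 U' x o v N N'

/-- **(T3) — positive association in the frame, finite-sum form** (the diagonal `N = N′ = Y`): in `G[U]`, for `o ≠ v` and `Y ⊆ U`,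
`e(Y) · pv(Y) ≤ pm(Y) · a(Y)`, i.e. `μ(o~v, v≁x, {x,o}↮Y)·μ(v~x, o≁{x,v}, {x,o}↮Y) ≤ μ(x,o,v pairwise separated, {x,o,v}↮Y)·μ(o∈C_x, x↮Y)`.
[cite: VandenbergHaggstromKahn2005, Thm. 1.1 (pp. 3–5)] [cite: KozmaNitzan2024, Question 8 (§5.5 p. 36)] -/
theorem t3_frame (w : Sym2 V → ℝ) (hw0 : ∀ e, 0 ≤ w e) (hw1 : ∀ e, w e ≤ 1) (hm : ∑ ω, weight w ω = 1)
    {x o v : V} (hov : o ≠ v) (U : Finset V) {Y : Set V} (hY : Y ⊆ ↑U) :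
    eT w U x o v Y * pvT w U x o v Y ≤ pmT w U x o v Y * Eav w U ∅ o x Y := by
  have h := t3_twoSource w hw0 hw1 hm (x := x) hov U Y Y hY hY
  simpa only [Set.union_self, Set.inter_self] using h



end PcovJ1

end Summit.CriticalPhenomena.PercolationContinuityZ3.Theorems

end
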